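import Summits.QuantumFields.YangMills.Theorems.ParabolicTrajectoryLatticeGapOnTrajectoryStepScalingDefs
import Summits.QuantumFields.YangMills.Theorems.ParabolicTrajectoryLatticeGapOnTrajectoryTransferHankelSiteStrict
import Summits.QuantumFields.YangMills.Theorems.ParabolicTrajectoryLatticeGapOnTrajectoryStubNegReflectRP
import HarnessLib

/-!
# Crux `LatticeGapOnTrajectory` (stmt-QuantumFields-10523): the ladder and the rate floor
# (stub `stub_rateFloor`, line `step-scaling-contraction`, served slug `StepScalingSketch`)

Helper file (`--supports stmt-QuantumFields-10523`) proving the registered stub `stub_rateFloor` of the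
skeleton `Cruxes/LatticeGapOnTrajectory/Lines/step_scaling_contraction.lean` (signature verbatim), the
G-blind engine of the line: an anchor `μ ≤ ζ_k(M^{n_k})`, `μ > 0`, read with the law's thermal constant,
and a uniform volume-doubling law `Φ(ζ_k(S)) ≤ ζ_k(2S)`, `λ ζ_k(S) ≤ ζ_k(S')` (`S ≤ S' ≤ 2S`) give, for an
`M`-adic scheme (`a_k = M^{-n_k}`) with `β_k → ∞`, the finite-volume OS gap statement `TorusGapAt` at the
lattice rate `Δ · a_k` on EVERY torus `S ≥ M^{n_k}`, eventually in `k`, with `Δ = λ c(Φ, μ) / 5`.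

* §1 `StepLaw.exists_ladder_const` — THE LADDER (pure real analysis): for a continuous `Φ` with
  `ζ < Φ ζ` on `(0, ∞)` and `2ζ − C ≤ Φ ζ` for `ζ ≥ ζ₁`, every orbit `μ ≤ z₀`, `Φ(z_j) ≤ z_{j+1}` satisfies
  `c · 2^j ≤ z_j` with `c = c(law, μ) > 0` INDEPENDENT of the orbit: on the compact window `[μ, Z]`
  (`Z = max(ζ₁, C⁺ + 2, μ)`) the continuous `Φ ζ − ζ` has a positive minimum `η`, so the orbit leaves the
  window after at most `J = ⌈(Z − μ)/η⌉ + 1` steps, after which `z_j − C⁺` doubles at every step.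
* §2 the finite-volume gap: `exists_dyadic_bracket` (`D 2^j ≤ S < D 2^{j+1}`); `kappa_nonneg_of_torusGapAt`
  (on a torus with `S ≥ 1` the statement `TorusGapAt` at ANY rate forces `0 ≤ κ`: test it on the constant
  observable); `torusGapAt_anti` (downward closure in the rate for `β ≥ 0`, from `osVar ≥ 0` — site
  reflection positivity `stub_negReflectRP`, p120012, in the OS-variance form
  `HankelSite.osVar_negReflect_nonneg_of_rp_lt`, p120231); `torusGapAt_of_ladder` (rates on the ladder:
  `ζ(S) ≥ λ c 2^j` for `D2^j ≤ S < D 2^{j+1}`, so `fvGap(S) ≥ λc/(4D) > (λc/5)/D`, a rate below the supremum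
  `fvGap` is attained up to `ε` (`exists_lt_of_lt_csSup`) and closed downwards).
* §3 `stub_rateFloor` — assembly along the eventual set where the anchor, the law and `0 ≤ β_k` hold.

References: Lüscher–Weisz–Wolff, Nucl. Phys. B 359 (1991) 221, §2 (step scaling `z = m(ℓ)ℓ`); Lüscher,
Commun. Math. Phys. 104 (1986) 177, §1–2; Osterwalder–Seiler, Ann. Phys. 110 (1978) 440, §2; Glimm–Jaffe,
Quantum Physics (1987), §19.7.
-/

open scoped ComplexConjugate Topology
open Filter MeasureTheory
open Literature.MathematicalPhysics.QuantumLattice Literature.MathematicalPhysics.QuantumFieldTheory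
open Summit.QuantumFields.YangMills.Theses.ParabolicTrajectory
open Summit.QuantumFields.YangMills.Cruxes.LatticeGapOnTrajectory.OrbitKantorovichFiniteSize

noncomputable section

namespace Summit.QuantumFields.YangMills.Cruxes.LatticeGapOnTrajectory.StepScaling

/-! ## §1 The ladder lemma (pure real analysis) -/

section Ladder

/-- **The ladder lemma.** For a volume-doubling law (`Φ` continuous, `ζ < Φ ζ` for `ζ > 0`,
`2ζ − C ≤ Φ ζ` for `ζ ≥ ζ₁`) and an anchor `μ > 0` there is `c = c(law, μ) > 0` such that EVERY real
sequence with `μ ≤ z 0` and `Φ (z j) ≤ z (j+1)` satisfies `c · 2^j ≤ z j` for all `j`. The window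
`[μ, Z]`, `Z = max (max ζ₁ (C⁺ + 2)) μ`, is compact, so `η = min_{[μ,Z]} (Φ ζ − ζ) > 0`; the (increasing)
orbit gains `η` per step inside the window, hence leaves it by step `J = ⌈(Z − μ)/η⌉₊ + 1`, and beyond it
`z_{j+1} − C⁺ ≥ 2 (z_j − C⁺) ≥ 4`; `c = min μ 1 / 2^J`. (Lüscher–Weisz–Wolff 1991 §2: orbits of a
fixed-point-free step-scaling function.) -/
theorem StepLaw.exists_ladder_const (law : StepLaw) {μ : ℝ} (hμ : 0 < μ) :
    ∃ c : ℝ, 0 < c ∧ ∀ z : ℕ → ℝ, μ ≤ z 0 → (∀ j, law.Φ (z j) ≤ z (j + 1)) →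
      ∀ j : ℕ, c * 2 ^ j ≤ z j := by
  obtain ⟨Cp, hC0, hCC⟩ : ∃ Cp : ℝ, 0 ≤ Cp ∧ law.C ≤ Cp :=
    ⟨max law.C 0, le_max_right _ _, le_max_left _ _⟩
  obtain ⟨Z, hμZ, hζZ, hCZ⟩ : ∃ Z : ℝ, μ ≤ Z ∧ law.ζ₁ ≤ Z ∧ Cp + 2 ≤ Z :=
    ⟨max (max law.ζ₁ (Cp + 2)) μ, le_max_right _ _, (le_max_left _ _).trans (le_max_left _ _),
      (le_max_right _ _).trans (le_max_left _ _)⟩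
  -- the positive minimum of `Φ ζ - ζ` on the compact window `[μ, Z]`
  obtain ⟨η, hη0, hηle⟩ : ∃ η : ℝ, 0 < η ∧ ∀ ζ, μ ≤ ζ → ζ ≤ Z → η ≤ law.Φ ζ - ζ := by
    obtain ⟨ζ₀, hζ₀K, hmin⟩ := (isCompact_Icc : IsCompact (Set.Icc μ Z)).exists_isMinOn
      (Set.nonempty_Icc.2 hμZ) (f := fun ζ => law.Φ ζ - ζ)
      (law.continuous.sub continuous_id).continuousOn
    exact ⟨law.Φ ζ₀ - ζ₀, sub_pos.2 (law.lt_map ζ₀ (hμ.trans_le hζ₀K.1)),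
      fun ζ h1 h2 => isMinOn_iff.1 hmin ζ ⟨h1, h2⟩⟩
  -- the exit step
  obtain ⟨J, hJ⟩ : ∃ J : ℕ, Z < μ + J * η := by
    refine ⟨⌈(Z - μ) / η⌉₊ + 1, ?_⟩
    have h1 : (Z - μ) / η ≤ ⌈(Z - μ) / η⌉₊ := Nat.le_ceil _
    rw [div_le_iff₀ hη0] at h1
    have e : ((⌈(Z - μ) / η⌉₊ + 1 : ℕ) : ℝ) * η = ⌈(Z - μ) / η⌉₊ * η + η := by push_cast; ring
    rw [e]
    linarith
  refine ⟨min μ 1 / 2 ^ J, div_pos (lt_min hμ one_pos) (pow_pos two_pos J), ?_⟩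
  intro z hz0 hstep
  -- the orbit is increasing and stays above `μ`
  have hzμ : ∀ j, μ ≤ z j := by
    intro j
    induction j with
    | zero => exact hz0
    | succ j ih => exact ih.trans ((law.lt_map _ (hμ.trans_le ih)).le.trans (hstep j))
  have hzlt : ∀ j, z j < z (j + 1) := fun j =>
    (law.lt_map _ (hμ.trans_le (hzμ j))).trans_le (hstep j)
  -- inside the window the orbit gains `η` per step
  have hdich : ∀ j : ℕ, Z < z j ∨ μ + j * η ≤ z j := by
    intro j
    induction j with
    | zero => exact Or.inr (by simpa using hz0)
    | succ j ih =>
      rcases lt_or_ge Z (z j) with h | h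
      · exact Or.inl (h.trans (hzlt j))
      · rcases ih with h' | h'
        · exact absurd h' (not_lt.2 h)
        · refine Or.inr ?_
          have h1 := hηle (z j) (hzμ j) h
          have h2 := hstep j
          push_cast
          linarith
  -- beyond the exit step the orbit is above the window
  have hbig : ∀ i : ℕ, Z < z (J + i) := by
    intro i
    rcases hdich (J + i) with h | h
    · exact h
    · have h1 : (0 : ℝ) ≤ i * η := by positivity
      push_cast at h
      linarith
  -- and `z - C⁺` doubles at every step
  have hdoub : ∀ i : ℕ, 2 ^ (i + 1) + Cp ≤ z (J + i) := by
    intro i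
    induction i with
    | zero =>
      have := hbig 0
      norm_num at this ⊢
      linarith
    | succ i ih =>
      have h1 : Z < z (J + i) := hbig i
      have h2 : 2 * z (J + i) - law.C ≤ law.Φ (z (J + i)) :=
        law.two_mul_sub_le _ (hζZ.trans h1.le)
      have h3 := hstep (J + i)
      have e : J + (i + 1) = J + i + 1 := rfl
      rw [e, pow_succ]
      linarith
  -- conclusion
  intro j
  rcases lt_or_ge j J with hj | hj
  · have h1 : (2 : ℝ) ^ j ≤ 2 ^ J := pow_le_pow_right₀ one_le_two hj.le
    have h0 : 0 ≤ min μ 1 := le_min hμ.le zero_le_one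
    have h2 : min μ 1 / 2 ^ J * 2 ^ j ≤ min μ 1 := by
      rw [div_mul_eq_mul_div, div_le_iff₀ (pow_pos two_pos J)]
      exact mul_le_mul_of_nonneg_left h1 h0
    exact h2.trans ((min_le_left _ _).trans (hzμ j))
  · obtain ⟨i, rfl⟩ := Nat.exists_eq_add_of_le hj
    have h1 := hdoub i
    have h2 : min μ 1 / 2 ^ J * 2 ^ (J + i) = min μ 1 * 2 ^ i := by
      rw [pow_add]
      field_simp
    rw [h2]
    have h3 : min μ 1 * 2 ^ i ≤ 2 ^ i := by
      have : min μ 1 ≤ 1 := min_le_right _ _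
      have : (0 : ℝ) < 2 ^ i := pow_pos two_pos i
      nlinarith
    have h4 : (2 : ℝ) ^ i ≤ 2 ^ (i + 1) := by
      rw [pow_succ]
      have : (0 : ℝ) < 2 ^ i := pow_pos two_pos i
      linarith
    linarith

end Ladder

/-! ## §2 The finite-volume gap: dyadic bracketing, the sign of `κ`, downward closure, rates -/

section Gap

variable {G : Type} [Group G] [TopologicalSpace G] [IsTopologicalGroup G] [CompactSpace G]
  [MeasurableSpace G] [BorelSpace G] {N : ℕ}

/-- Dyadic bracketing above an anchor side `D ≥ 1`: every `S ≥ D` satisfies `D 2^j ≤ S < D 2^{j+1}`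
for some `j` (the least `j` with `S < D 2^{j+1}`). -/
theorem exists_dyadic_bracket {D S : ℕ} (hD : 1 ≤ D) (hS : D ≤ S) :
    ∃ j : ℕ, D * 2 ^ j ≤ S ∧ S < D * 2 ^ (j + 1) := by
  have hex : ∃ j : ℕ, S < D * 2 ^ (j + 1) := by
    refine ⟨S, ?_⟩
    calc S < 2 ^ S := Nat.lt_two_pow_self
      _ ≤ 2 ^ (S + 1) := Nat.pow_le_pow_right (by norm_num) (Nat.le_succ S)
      _ ≤ D * 2 ^ (S + 1) := Nat.le_mul_of_pos_left _ hD
  refine ⟨Nat.find hex, ?_, Nat.find_spec hex⟩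
  rcases h : Nat.find hex with _ | j
  · simpa using hS
  · have := Nat.find_min hex (show j < Nat.find hex by omega)
    exact not_lt.1 this

/-- **The thermal constant is non-negative whenever `TorusGapAt` holds at some rate** (`S ≥ 1`): test the
statement on the constant observable `X ≡ 1` (`B = 1`, `w = n = 0`), whose reflected autocorrelation and
OS variance vanish under the probability measure `wilsonMeasure ρ β`; the inequality reads
`0 ≤ κ e^{−m(2S+1)}`. -/
theorem kappa_nonneg_of_torusGapAt {ρ : G →* Matrix (Fin N) (Fin N) ℂ} (hρ : Continuous ρ) (β : ℝ)
    {S : ℕ} (hS : 1 ≤ S) {m κ : ℝ} (h : TorusGapAt ρ β S m κ) : 0 ≤ κ := by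
  haveI := isProbabilityMeasure_wilsonMeasure (d := 4) (L := 2 * S + 1) (G := G) ρ hρ β
  have h1 := h 0 0 (fun _ => (1 : ℂ)) 1 measurable_const (fun U => by simp) (fun _ _ _ => rfl)
    (by omega) (by omega)
  simp [osCorr, osVar] at h1
  exact (mul_nonneg_iff_of_pos_right (Real.exp_pos _)).1 h1

/-- **Downward closure of `TorusGapAt` in the rate** (`β ≥ 0`, `κ ≥ 0`): both terms of the bound are
antitone in `m`, the first because `0 ≤ osVar μ Θ₀ X` for `[1,w]`-slab observables with `w < S` — site
reflection positivity of the odd Wilson torus (`stub_negReflectRP`, in the OS-variance form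
`HankelSite.osVar_negReflect_nonneg_of_rp_lt`) — the second because `2S+1−n−2w ≥ 0`.
(Osterwalder–Seiler 1978 §2.) -/
theorem torusGapAt_anti {ρ : G →* Matrix (Fin N) (Fin N) ℂ} (hρ : Continuous ρ) {β : ℝ} (hβ : 0 ≤ β)
    {S : ℕ} {m m' κ : ℝ} (hκ : 0 ≤ κ) (hle : m' ≤ m) (h : TorusGapAt ρ β S m κ) :
    TorusGapAt ρ β S m' κ := by
  intro w n X B hX hB hdep hw hn
  have hS : 1 ≤ S := by omega
  have hV := Transfer.HankelSite.osVar_negReflect_nonneg_of_rp_lt ρ hρ β (stub_negReflectRP ρ hρ hβ hS)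
    hX ⟨B, hB⟩ hw hdep
  refine (h w n X B hX hB hdep hw hn).trans (add_le_add ?_ ?_)
  · refine mul_le_mul_of_nonneg_left (Real.exp_le_exp.2 ?_) hV
    have : m' * n ≤ m * n := mul_le_mul_of_nonneg_right hle (Nat.cast_nonneg n)
    linarith
  · refine mul_le_mul_of_nonneg_left (Real.exp_le_exp.2 ?_) (mul_nonneg hκ (sq_nonneg B))
    have hT : (0 : ℝ) ≤ (2 * S + 1 : ℝ) - n - 2 * w := by
      have : (n : ℝ) + 2 * w ≤ 2 * S + 1 := by exact_mod_cast hn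
      linarith
    have : m' * ((2 * S + 1 : ℝ) - n - 2 * w) ≤ m * ((2 * S + 1 : ℝ) - n - 2 * w) :=
      mul_le_mul_of_nonneg_right hle hT
    linarith

/-- **Rates on the ladder.** At a coupling `β ≥ 0`, an anchor `μ ≤ ζ(D)` (`D ≥ 1`), the doubling law
`Φ(ζ(S)) ≤ ζ(2S)` and the intermediate-volume bound `λ ζ(S) ≤ ζ(S')` (`S ≤ S' ≤ 2S`) for all `S ≥ D`, with
the ladder constant `c` of `StepLaw.exists_ladder_const`, give `TorusGapAt` at rate `(λ c / 5) / D` on every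
torus `S ≥ D`: the doubled boxes `D 2^j` form an orbit of the law, so `ζ(D 2^j) ≥ c 2^j`; bracketing
`D 2^j ≤ S < D 2^{j+1}` gives `ζ(S) ≥ λ c 2^j` and `2S+1 ≤ 4 D 2^j`, so `fvGap(S) ≥ λc/(4D) > (λc/5)/D`; a
rate strictly below the supremum `fvGap(S)` lies below an admissible rate (`exists_lt_of_lt_csSup`; the
admissible set is non-empty since `fvGap(S) > 0 = sSup ∅`), which forces `κ ≥ 0`
(`kappa_nonneg_of_torusGapAt`) and is closed downwards (`torusGapAt_anti`). -/
theorem torusGapAt_of_ladder {ρ : G →* Matrix (Fin N) (Fin N) ℂ} (hρ : Continuous ρ) {β : ℝ}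
    (hβ : 0 ≤ β) (law : StepLaw) {μ c : ℝ} (hc : 0 < c)
    (hlad : ∀ z : ℕ → ℝ, μ ≤ z 0 → (∀ j, law.Φ (z j) ≤ z (j + 1)) → ∀ j : ℕ, c * 2 ^ j ≤ z j)
    {D : ℕ} (hD : 1 ≤ D) (hbox : μ ≤ zeta ρ β D law.κ)
    (hlaw : ∀ S : ℕ, D ≤ S → law.Φ (zeta ρ β S law.κ) ≤ zeta ρ β (2 * S) law.κ ∧
      ∀ S' : ℕ, S ≤ S' → S' ≤ 2 * S → law.lam * zeta ρ β S law.κ ≤ zeta ρ β S' law.κ)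
    {S : ℕ} (hS : D ≤ S) : TorusGapAt ρ β S (law.lam * c / 5 * (D : ℝ)⁻¹) law.κ := by
  -- the orbit of doubled boxes
  have hzj : ∀ j : ℕ, c * 2 ^ j ≤ zeta ρ β (D * 2 ^ j) law.κ := by
    refine hlad (fun j => zeta ρ β (D * 2 ^ j) law.κ) ?_ ?_
    · simpa using hbox
    · intro j
      have h := (hlaw (D * 2 ^ j) (Nat.le_mul_of_pos_right _ (Nat.two_pow_pos j))).1
      have e : 2 * (D * 2 ^ j) = D * 2 ^ (j + 1) := by ring
      rw [e] at h
      simpa using h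
  -- bracket `S`
  obtain ⟨j, hj1, hj2⟩ := exists_dyadic_bracket hD hS
  have hP2 : D * 2 ^ (j + 1) = 2 * (D * 2 ^ j) := by ring
  rw [hP2] at hj2
  have hlam : law.lam * zeta ρ β (D * 2 ^ j) law.κ ≤ zeta ρ β S law.κ :=
    (hlaw (D * 2 ^ j) (Nat.le_mul_of_pos_right _ (Nat.two_pow_pos j))).2 S hj1 hj2.le
  have hq : law.lam * (c * 2 ^ j) ≤ (2 * S + 1 : ℝ) * fvGap ρ β S law.κ :=
    (mul_le_mul_of_nonneg_left (hzj j) law.lam_pos.le).trans hlam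
  have hT : (2 * S + 1 : ℝ) ≤ 4 * ((D : ℝ) * 2 ^ j) := by
    have h1 : S + 1 ≤ 2 * (D * 2 ^ j) := hj2
    have h2 : ((S + 1 : ℕ) : ℝ) ≤ ((2 * (D * 2 ^ j) : ℕ) : ℝ) := by exact_mod_cast h1
    push_cast at h2
    linarith
  have hpos : 0 < law.lam * (c * 2 ^ j) := mul_pos law.lam_pos (mul_pos hc (pow_pos two_pos j))
  have hFpos : 0 < fvGap ρ β S law.κ := by
    have h1 : 0 < (2 * S + 1 : ℝ) * fvGap ρ β S law.κ := hpos.trans_le hq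
    exact pos_of_mul_pos_right h1 (by positivity)
  have h3 : law.lam * c * 2 ^ j ≤ 4 * D * fvGap ρ β S law.κ * 2 ^ j := by
    have := hq.trans (mul_le_mul_of_nonneg_right hT hFpos.le)
    linarith
  have h4 : law.lam * c ≤ 4 * D * fvGap ρ β S law.κ := le_of_mul_le_mul_right h3 (pow_pos two_pos j)
  have hDpos : (0 : ℝ) < D := by exact_mod_cast hD
  have hlt : law.lam * c / 5 * (D : ℝ)⁻¹ < fvGap ρ β S law.κ := by
    rw [← div_eq_mul_inv, div_div, div_lt_iff₀ (by positivity)]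
    nlinarith [mul_pos hDpos hFpos, h4]
  -- a rate strictly below the supremum lies below an admissible rate
  have hne : {m : ℝ | 0 ≤ m ∧ m ≤ 1 ∧ TorusGapAt ρ β S m law.κ}.Nonempty := by
    by_contra hemp
    rw [Set.not_nonempty_iff_eq_empty] at hemp
    have : fvGap ρ β S law.κ = 0 := by rw [fvGap, hemp, Real.sSup_empty]
    exact hFpos.ne' this
  obtain ⟨m, ⟨_, _, hm⟩, hltm⟩ := exists_lt_of_lt_csSup hne hlt
  have hκ : 0 ≤ law.κ := kappa_nonneg_of_torusGapAt hρ β (hD.trans hS) hm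
  exact torusGapAt_anti hρ hβ hκ hltm.le hm

end Gap

/-! ## §3 The registered stub -/

/-- **stub_rateFloor** (registered stub of the skeleton `Lines/step_scaling_contraction.lean`, signature
verbatim) — LADDER + RATE FLOOR, the G-blind engine of the line. For an `M`-adic scheme (`a_k = M^{-n_k}`)
with `β_k → ∞`, an anchor `μ > 0` at the box `M^{n_k}` read with the law's thermal constant and a uniform
step-scaling law give a `k`-uniform rate floor: `TorusGapAt` at the lattice rate `Δ · a_k` on every torus
`S ≥ M^{n_k}`, eventually in `k`, with `Δ = λ c(law, μ) / 5` (`c` the orbit-independent constant of the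
ladder lemma `StepLaw.exists_ladder_const`). Along the eventual set where the anchor, the law and
`0 ≤ β_k` hold this is `torusGapAt_of_ladder`; `β_k ≥ 0` enters only through the downward closure of
`TorusGapAt` in the rate (site reflection positivity). (Lüscher–Weisz–Wolff 1991 §2; Glimm–Jaffe 1987 §19.7.) -/
theorem stub_rateFloor :
    ∀ (G : Type) [Group G] [TopologicalSpace G] [IsTopologicalGroup G] [CompactSpace G]
      [MeasurableSpace G] [BorelSpace G] (r : LatticeRep G) (M : ℕ) (sch : SpeciesScheme (YMSpecies G))
      (n : ℕ → ℕ) (law : StepLaw) (μ : ℝ),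
        2 ≤ M → (∀ k, sch.a k = ((M : ℝ) ^ n k)⁻¹) → Tendsto sch.β atTop atTop → 0 < μ →
        TunedBoxGap r sch (fun k => M ^ n k) law.κ μ → UniformStepScaling r sch (fun k => M ^ n k) law →
        ∃ Δ : ℝ, 0 < Δ ∧ RateFloor r sch (fun k => M ^ n k) law.κ Δ := by
  intro G _ _ _ _ _ _ r M sch n law μ hM ha hβ hμ hbox hlaw
  obtain ⟨c, hc, hlad⟩ := law.exists_ladder_const hμ
  refine ⟨law.lam * c / 5, by have := law.lam_pos; positivity, ?_⟩
  have hbox' : ∀ᶠ k in atTop, μ ≤ zeta r.ρ (sch.β k) (M ^ n k) law.κ := hbox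
  have hlaw' : ∀ᶠ k in atTop, ∀ S : ℕ, M ^ n k ≤ S →
      law.Φ (zeta r.ρ (sch.β k) S law.κ) ≤ zeta r.ρ (sch.β k) (2 * S) law.κ ∧
        ∀ S' : ℕ, S ≤ S' → S' ≤ 2 * S →
          law.lam * zeta r.ρ (sch.β k) S law.κ ≤ zeta r.ρ (sch.β k) S' law.κ := hlaw
  have hβ0 : ∀ᶠ k in atTop, 0 ≤ sch.β k := hβ.eventually_ge_atTop 0
  show ∀ᶠ k in atTop, ∀ S : ℕ, M ^ n k ≤ S → TorusGapAt r.ρ (sch.β k) S (law.lam * c / 5 * sch.a k) law.κ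
  filter_upwards [hbox', hlaw', hβ0] with k hboxk hlawk hβk
  intro S hS
  have hD : 1 ≤ M ^ n k := Nat.one_le_pow _ _ (by omega)
  have h := torusGapAt_of_ladder r.continuous hβk law hc hlad hD hboxk hlawk hS
  rw [ha k]
  simpa only [Nat.cast_pow] using h

end Summit.QuantumFields.YangMills.Cruxes.LatticeGapOnTrajectory.StepScaling

end
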